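import Summits.CriticalPhenomena.PercolationContinuityZ3.Theorems.PercGamblersRuinSymmetricSlabCalibration

/-!
# Route `PercGamblersRuin`, crux `VerticalGamblersRuin` (stmt-CriticalPhenomena-10642):
# stub `stub_goodPlateOfNoDrift` — from "no drift" to "good plate" (translation + Markov)

Helper file for the stub `stub_goodPlateOfNoDrift` of the line `registered` of the crux
`PercGamblersRuin.VerticalGamblersRuin` (stmt-CriticalPhenomena-10642).

Setting: bond configurations `ω` on `ℤ³` (`Site 3 = Fin 3 → ℤ`, height coordinate `x 0`); a
*slab voltage* of the open slab `(-a, b)` for `ω` is a function `ℤ³ → [0, 1]`, equal to `1` on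
the ceiling region `{b ≤ x₀}`, to `0` on the floor region `{x₀ ≤ -a}`, and harmonic for the OPEN
lattice edges of `ω` at every site of `{-a < x₀ < b}`.

Statement proved (pure glue between two statements of the line).  HYPOTHESIS ("no drift", the
statement of the neighbouring open stub, taken here as an assumption): for every `η > 0` there
are `k > 0` and `N` such that for all `n ≥ N` and every selection `v : Ω → ℤ³ → ℝ` of voltages of
the lopsided slab `(-2kn, n)` with `ω ↦ v ω 0` measurable, `∫_{0 ↔ ∞} (1 - v(ω, 0)) dP_{p_c} ≤ η`.
CONCLUSION ("good plate"): for every `ε > 0` there are `k > 0`, `κ > 0` and `N₁` such that for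
all `n ≥ N₁`, every selection `v` of voltages of the slab `(-kn, (k+1)n)` measurable at every
site, and every site `x` of the plate `{x₀ = kn}`, `P_{p_c}(v(ω, x) < κ, x ↔ ∞) ≤ ε`.  (The
hypothesis `θ(p_c) > 0` of the registered signature is not used.)

Proof.  Take `κ = 1/2` and `k, N` from the hypothesis with `η = ε/2`; `N₁ = N`.  Fix `n ≥ N`, `v`
and a plate site `x`.  Transport by the lattice translation `y ↦ y + x`: with
`R = BondConfig.relabel (sym2Equiv (Site.shift x))` (`ω ↦ ω + x` on configurations) the field
`v' ω' y := v (R ω') (y + x)` is a voltage of the lopsided slab `(-2kn, n)` for every `ω'`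
(the plate regions are shifted by `x₀ = kn`; the harmonicity defect is reindexed along
`z ↦ z + x`, `zdGraph_adj_shift_iff`, `mk_add_mem_relabel_shift_iff`), measurable at `0`.  The
hypothesis gives `∫_{0 ↔ ∞} (1 - v'(ω', 0)) dP_{p_c} ≤ ε/2`.  By translation invariance of `P_{p_c}`
(`bondPercolation_real_preimage_shift`) and `R ω' ∈ {x ↔ ∞} ↔ ω' ∈ {0 ↔ ∞}`
(`relabel_mem_percolatesAt_iff`), `P(v(ω, x) < 1/2, x ↔ ∞) = P(v'(ω', 0) < 1/2, 0 ↔ ∞)`, and by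
Markov's inequality (on the latter event `1 - v' ≥ 1/2`, and `1 - v' ≥ 0` everywhere)
`(1/2) · P(v'(ω', 0) < 1/2, 0 ↔ ∞) ≤ ∫_{0 ↔ ∞} (1 - v') ≤ ε/2`.

## References

* G. Grimmett, *Percolation*, 2nd ed., Springer (1999), §1.6 (translation invariance of `P_p`),
  §1.4 (the event `{x ↔ ∞}`).
* R. Lyons, Y. Peres, *Probability on Trees and Networks*, Cambridge University Press (2016),
  §2.1 (voltages / harmonic functions on networks).
-/

noncomputable section

namespace Summit.CriticalPhenomena.PercolationContinuityZ3.Theorems.VerticalGamblersRuin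

open MeasureTheory Filter Topology
open Literature.Probability.Percolation Literature.Probability.LatticeModels
open scoped Classical

namespace StubGoodPlateOfNoDrift

/-- **Harmonicity defects are transported by translations.** For a configuration `ω'`, a site
`x`, a function `f` on `ℤ³` and a site `y`, the defect at `y` of `z ↦ f (z + x)` for the open
lattice edges of `ω'` equals the defect at `y + x` of `f` for the open lattice edges of the
shifted configuration `ω' + x = BondConfig.relabel (sym2Equiv (Site.shift x)) ω'` (reindex the sum
along `z ↦ z + x`; `zdGraph_adj_shift_iff`, `mk_add_mem_relabel_shift_iff`). -/
theorem defect_shift (x : Site 3) (ω' : BondConfig (Site 3)) (f : Site 3 → ℝ) (y : Site 3) :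
    ∑ z ∈ ((zdGraph 3).neighborFinset y).filter (fun z => s(y, z) ∈ ω'), (f (z + x) - f (y + x)) =
      ∑ z ∈ ((zdGraph 3).neighborFinset (y + x)).filter
        (fun z => s(y + x, z) ∈ BondConfig.relabel (sym2Equiv (Site.shift x)) ω'),
          (f z - f (y + x)) := by
  refine Finset.sum_equiv (Site.shift x) (fun z => ?_) (fun z _ => rfl)
  have hadj : (zdGraph 3).Adj (y + x) (z + x) ↔ (zdGraph 3).Adj y z := zdGraph_adj_shift_iff x y z
  have hmem : s(y + x, z + x) ∈ BondConfig.relabel (sym2Equiv (Site.shift x)) ω' ↔ s(y, z) ∈ ω' :=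
    mk_add_mem_relabel_shift_iff x ω' y z
  simp only [Finset.mem_filter, SimpleGraph.mem_neighborFinset, Site.shift_apply, hadj, hmem]

/-- **Translated voltages.** If `f` is a voltage of the slab `(-kn, (k+1)n)` for the shifted
configuration `ω' + x`, where `x` is a site of the plate `{x₀ = kn}`, then `y ↦ f (y + x)` is a
voltage of the lopsided slab `(-2kn, n)` for `ω'` (values in `[0, 1]`, ceiling datum `1` on
`{n ≤ y₀}`, floor datum `0` on `{y₀ ≤ -2kn}`, harmonic for the open lattice edges of `ω'` at
`-2kn < y₀ < n`). -/
theorem shifted_voltage {k n : ℕ} {x : Site 3} (hx : x 0 = ((k * n : ℕ) : ℤ))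
    {ω' : BondConfig (Site 3)} {f : Site 3 → ℝ}
    (hb : ∀ y, 0 ≤ f y ∧ f y ≤ 1)
    (htop : ∀ y : Site 3, (((k + 1) * n : ℕ) : ℤ) ≤ y 0 → f y = 1)
    (hbot : ∀ y : Site 3, y 0 ≤ -((k * n : ℕ) : ℤ) → f y = 0)
    (hharm : ∀ y : Site 3, -((k * n : ℕ) : ℤ) < y 0 → y 0 < (((k + 1) * n : ℕ) : ℤ) →
      ∑ z ∈ ((zdGraph 3).neighborFinset y).filter
        (fun z => s(y, z) ∈ BondConfig.relabel (sym2Equiv (Site.shift x)) ω'), (f z - f y) = 0) :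
    (∀ y, 0 ≤ f (y + x) ∧ f (y + x) ≤ 1) ∧
      (∀ y : Site 3, (n : ℤ) ≤ y 0 → f (y + x) = 1) ∧
      (∀ y : Site 3, y 0 ≤ -((2 * k * n : ℕ) : ℤ) → f (y + x) = 0) ∧
      ∀ y : Site 3, -((2 * k * n : ℕ) : ℤ) < y 0 → y 0 < (n : ℤ) →
        ∑ z ∈ ((zdGraph 3).neighborFinset y).filter (fun z => s(y, z) ∈ ω'),
          (f (z + x) - f (y + x)) = 0 := by
  have h0 : ∀ y : Site 3, (y + x) 0 = y 0 + ((k * n : ℕ) : ℤ) := fun y => by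
    rw [Pi.add_apply, hx]
  refine ⟨fun y => hb (y + x), fun y hy => htop _ ?_, fun y hy => hbot _ ?_,
    fun y hy1 hy2 => ?_⟩
  · rw [h0]; push_cast at hy ⊢; linarith
  · rw [h0]; push_cast at hy ⊢; linarith
  · rw [defect_shift]
    refine hharm _ ?_ ?_
    · rw [h0]; push_cast at hy1 ⊢; linarith
    · rw [h0]; push_cast at hy2 ⊢; linarith

/-- **Markov step.** For a finite measure `μ`, a measurable `g : Ω → [0, 1]` and a measurable
event `T`: `(1/2) · μ({g < 1/2} ∩ T) ≤ ∫_T (1 - g) dμ` (on `{g < 1/2}` the integrand is `≥ 1/2`,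
and it is `≥ 0` on all of `T`). -/
theorem half_measureReal_le_setIntegral {Ω : Type*} [MeasurableSpace Ω] {μ : Measure Ω}
    [IsFiniteMeasure μ] {g : Ω → ℝ} (hg : Measurable g) (hb : ∀ ω, 0 ≤ g ω ∧ g ω ≤ 1)
    {T : Set Ω} (hT : MeasurableSet T) :
    (1 / 2 : ℝ) * μ.real ({ω | g ω < 1 / 2} ∩ T) ≤ ∫ ω in T, (1 - g ω) ∂μ := by
  have hSm : MeasurableSet ({ω | g ω < 1 / 2} ∩ T) :=
    (measurableSet_lt hg measurable_const).inter hT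
  have hint : Integrable (fun ω => 1 - g ω) μ :=
    (integrable_const 1).sub (Integrable.of_bound hg.aestronglyMeasurable 1
      (Eventually.of_forall fun ω => by
        rw [Real.norm_eq_abs, abs_of_nonneg (hb ω).1]
        exact (hb ω).2))
  calc (1 / 2 : ℝ) * μ.real ({ω | g ω < 1 / 2} ∩ T)
      = ∫ _ in {ω | g ω < 1 / 2} ∩ T, (1 / 2 : ℝ) ∂μ := by
        rw [setIntegral_const, smul_eq_mul, mul_comm]
    _ ≤ ∫ ω in {ω | g ω < 1 / 2} ∩ T, (1 - g ω) ∂μ :=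
        setIntegral_mono_on (integrable_const _).integrableOn hint.integrableOn hSm
          (fun ω hω => by
            have h : g ω < 1 / 2 := hω.1
            linarith)
    _ ≤ ∫ ω in T, (1 - g ω) ∂μ :=
        setIntegral_mono_set hint.integrableOn (ae_of_all _ fun ω => sub_nonneg.2 (hb ω).2)
          (LE.le.eventuallyLE Set.inter_subset_right)

end StubGoodPlateOfNoDrift

open StubGoodPlateOfNoDrift in
/-- **Stub `stub_goodPlateOfNoDrift` ("no drift" implies "good plate"; translation invariance of
`P_{p_c}` + Markov with `κ = 1/2`).**  Assume that for every `η > 0` there are `k > 0` and `N`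
such that for all `n ≥ N` and every selection `v : Ω → ℤ³ → [0, 1]` of voltages of the lopsided
slab `(-2kn, n)` (ceiling datum `1` on `{n ≤ x₀}`, floor datum `0` on `{x₀ ≤ -2kn}`, harmonic for
the open lattice edges in between) with `ω ↦ v ω 0` measurable,
`∫_{0 ↔ ∞} (1 - v(ω, 0)) dP_{p_c} ≤ η`.  Then (regardless of the second hypothesis `θ(p_c) > 0`)
for every `ε > 0` there are `k > 0`, `κ > 0` and `N₁` such that for all `n ≥ N₁`, every selection
`v` of voltages of the slab `(-kn, (k+1)n)` measurable at every site and every plate site `x`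
(`x₀ = kn`), `P_{p_c}(v(ω, x) < κ ∧ x ↔ ∞) ≤ ε`.  Proof: `κ = 1/2`, `η = ε/2`, `N₁ = N`;
transport `v` to `v' ω' y := v (ω' + x) (y + x)`, a voltage of the lopsided slab seen from the
origin (`shifted_voltage`), use translation invariance (`bondPercolation_real_preimage_shift`,
`relabel_mem_percolatesAt_iff`) and Markov (`half_measureReal_le_setIntegral`). -/
theorem stub_goodPlateOfNoDrift :
    (∀ η : ℝ, 0 < η → ∃ k : ℕ, 0 < k ∧ ∃ N : ℕ, ∀ n ≥ N,
      ∀ v : BondConfig (Site 3) → Site 3 → ℝ, Measurable (fun ω => v ω 0) →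
        (∀ ω, (∀ x, 0 ≤ v ω x ∧ v ω x ≤ 1) ∧
          (∀ x : Site 3, (n : ℤ) ≤ x 0 → v ω x = 1) ∧
          (∀ x : Site 3, x 0 ≤ -((2 * k * n : ℕ) : ℤ) → v ω x = 0) ∧
          ∀ x : Site 3, -((2 * k * n : ℕ) : ℤ) < x 0 → x 0 < (n : ℤ) →
            ∑ y ∈ ((zdGraph 3).neighborFinset x).filter (fun y => s(x, y) ∈ ω), (v ω y - v ω x) = 0) →
        ∫ ω in percolatesAt (0 : Site 3), (1 - v ω 0) ∂(bondPercolation (zdGraph 3) (criticalProbI 3)) ≤ η) →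
    0 < theta (zdGraph 3) (0 : Site 3) (criticalProbI 3) →
      ∀ ε : ℝ, 0 < ε → ∃ k : ℕ, 0 < k ∧ ∃ κ : ℝ, 0 < κ ∧ ∃ N₁ : ℕ, ∀ n ≥ N₁,
      ∀ v : BondConfig (Site 3) → Site 3 → ℝ, (∀ x, Measurable fun ω => v ω x) →
        (∀ ω, (∀ x, 0 ≤ v ω x ∧ v ω x ≤ 1) ∧
          (∀ x : Site 3, (((k + 1) * n : ℕ) : ℤ) ≤ x 0 → v ω x = 1) ∧
          (∀ x : Site 3, x 0 ≤ -((k * n : ℕ) : ℤ) → v ω x = 0) ∧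
          ∀ x : Site 3, -((k * n : ℕ) : ℤ) < x 0 → x 0 < (((k + 1) * n : ℕ) : ℤ) →
            ∑ y ∈ ((zdGraph 3).neighborFinset x).filter (fun y => s(x, y) ∈ ω), (v ω y - v ω x) = 0) →
        ∀ x : Site 3, x 0 = ((k * n : ℕ) : ℤ) →
          (bondPercolation (zdGraph 3) (criticalProbI 3)).real
            {ω | v ω x < κ ∧ ω ∈ percolatesAt x} ≤ ε := by
  intro hND _hθ ε hε
  obtain ⟨k, hk, N, hN⟩ := hND (ε / 2) (by linarith)
  refine ⟨k, hk, 1 / 2, by norm_num, N, ?_⟩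
  intro n hn v hvmeas hvsol x hx
  -- the translated field `v' ω' y = v (ω' + x) (y + x)` (an opaque name with its definition)
  obtain ⟨v', hv'⟩ : ∃ v' : BondConfig (Site 3) → Site 3 → ℝ,
      v' = fun ω' y => v (BondConfig.relabel (sym2Equiv (Site.shift x)) ω') (y + x) := ⟨_, rfl⟩
  have hv'app : ∀ ω' y, v' ω' y = v (BondConfig.relabel (sym2Equiv (Site.shift x)) ω') (y + x) :=
    fun ω' y => by rw [hv']
  -- Step 1: `v'` is a voltage of the lopsided slab `(-2kn, n)`, measurable at `0`
  have hv'meas : Measurable (fun ω' => v' ω' 0) := by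
    rw [hv']
    exact (hvmeas (0 + x)).comp (BondConfig.relabel (sym2Equiv (Site.shift x))).measurable
  have hv'sol : ∀ ω', (∀ y, 0 ≤ v' ω' y ∧ v' ω' y ≤ 1) ∧
      (∀ y : Site 3, (n : ℤ) ≤ y 0 → v' ω' y = 1) ∧
      (∀ y : Site 3, y 0 ≤ -((2 * k * n : ℕ) : ℤ) → v' ω' y = 0) ∧
      ∀ y : Site 3, -((2 * k * n : ℕ) : ℤ) < y 0 → y 0 < (n : ℤ) →
        ∑ z ∈ ((zdGraph 3).neighborFinset y).filter (fun z => s(y, z) ∈ ω'),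
          (v' ω' z - v' ω' y) = 0 := by
    intro ω'
    obtain ⟨hb, htop, hbot, hharm⟩ := hvsol (BondConfig.relabel (sym2Equiv (Site.shift x)) ω')
    have h := shifted_voltage hx hb htop hbot hharm
    simpa only [hv'app] using h
  -- Step 2: no drift for `v'`
  have hkey := hN n hn v' hv'meas hv'sol
  -- Step 3: transport the bad event to the origin
  have hperc : ∀ ω', BondConfig.relabel (sym2Equiv (Site.shift x)) ω' ∈ percolatesAt x ↔
      ω' ∈ percolatesAt (0 : Site 3) := by
    intro ω'
    have h := relabel_mem_percolatesAt_iff (Site.shift x) ω' (0 : Site 3)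
    rwa [Site.shift_apply, zero_add] at h
  have hev : BondConfig.relabel (sym2Equiv (Site.shift x)) ⁻¹'
        {ω | v ω x < 1 / 2 ∧ ω ∈ percolatesAt x} =
      {ω' | v' ω' 0 < 1 / 2} ∩ percolatesAt (0 : Site 3) := by
    ext ω'
    simp only [Set.mem_preimage, Set.mem_setOf_eq, Set.mem_inter_iff, hv'app, zero_add, hperc]
  rw [← bondPercolation_real_preimage_shift x (criticalProbI 3)
    {ω | v ω x < 1 / 2 ∧ ω ∈ percolatesAt x}, hev]
  -- Step 4: Markov
  have hM := half_measureReal_le_setIntegral (μ := bondPercolation (zdGraph 3) (criticalProbI 3))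
    hv'meas (fun ω' => (hv'sol ω').1 0) (measurableSet_percolatesAt_holds (0 : Site 3))
  linarith

end Summit.CriticalPhenomena.PercolationContinuityZ3.Theorems.VerticalGamblersRuin
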